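import Mathlib
import Summits.ResolutionOfSingularities.ResolutionOfSingularities.Theorems.WeightedInvariantLocalWeightedDropWildMonicKangarooFlagHeight
import Summits.ResolutionOfSingularities.ResolutionOfSingularities.Theorems.WeightedInvariantLocalWeightedDropWildMonicFlagDropAxisSplit
import Summits.ResolutionOfSingularities.ResolutionOfSingularities.Theorems.WeightedInvariantLocalWeightedDropWildMonicFlagSwapReading
import Summits.ResolutionOfSingularities.ResolutionOfSingularities.Theorems.WeightedInvariantLocalWeightedDropWildMonicFlagDropShear

/-!
# `WeightedInvariant.LocalWeightedDrop`, line `hasse-ridge-face-selection`, S3ρ flag line: Uk-ρD3 — `DropAxisKangaroo` FROM THE KANGAROO PACKAGE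

Crux item stmt-ResolutionOfSingularities-8899 `LocalWeightedDrop` (route `ResolutionOfSingularities/WeightedInvariant`), engine of the door
`HypersurfaceCentreConstruction` stmt-ResolutionOfSingularities-19897.  [OURS · L1 W4.3, chain w43, seat res-type-056 (Uk-ρD3, plan-1 DEALS gen 9 #12;
RULING gen 9 #7: flag line = tools).  MODEL: S. Perlega, arXiv:2011.14443 Ch. 9 Prop. 9.1.4 proof, case (4) at `t = 0` [cite: Perlega2020,
Prop. 9.1.4 (4): «Let the flag `𝓕 ∈ F(a)` be defined by `𝓕₂ = V(z)` and `𝓕₁ = V(z,y₁)` … we can assume that `f` is clean with respect to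
`J_{2,x₁}(a)` for any weighted order function … this implies that `𝓕` is valid … `d_𝓖 ≤ d₁ + ε ≤ d_𝓕/n_𝓖 + ε` … `inv(𝓖) < inv(𝓕)`»]; every object
OURS (res-L1-w43-stub-3's flag family, res-type-083's `DropAxisKangaroo` / `FirstDominates` / `IsAxisStep`); not a statement of any manuscript
[claim: Hironaka2017, status: under-review].]

THE PACKAGE (mirrors res-type-083's `AxisPackageN0`).  For a charged axis step `(A, E; T, φ′)` (child `C = shift d T φ′`, read for kangaroo flags
on the SWAPPED child `C♯ = swapT C`, whose letter `1` is the exceptional curve `D_new`) and a tangency `n ≥ 2`, Perlega's proof uses ONE canonical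
parent hypersurface `g₀` (simultaneously clean for `ord`, `ord_{(x)}`, `ord_{(y)}` and the source weight `(n, n+1)` of the kangaroo weight) and
its induced child re-centring `ψ`; `AxisPackageKangaroo d p k` records what the kangaroo needs from them:
 (i)  `F = (false, g₀, 0)` is a valid parent flag (`IsMMax d A E g₀ 0`);
 (ii) `d_𝓕 = dRes E (newtonSet (flagTuple d A g₀ 0)) > 0` (non-terminal: Per17 Lemma 7.4.11 / Prop. 7.4.5 (2) against the `Exit₃` hypothesis);
 (iii) the child tuple `flagTuple d C♯ ψ 0` is `(1,n)`-CLEAN with finite `m` (Prop. 6.1.1 (2): cleanness transported through the point step);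
 (iv) Prop. 6.2.4 (1): `n · dInit (1,n) (newtonSet (flagTuple d C♯ ψ 0)) ≤ d_𝓕` (`…WildMonicKangarooBlowupInit.mul_dInit_image_psi_le_dRes` once
      the child's Newton set is identified with `psi d! ''` the parent's — stub-7's `newtonSet_pointStep_axis₀` — and swapped).
`dropAxisKangaroo_of_package : AxisPackageKangaroo d p k → DropAxisKangaroo d p k` is then res-type-056's kangaroo bound in flag vocabulary
(`…WildMonicKangarooFlagHeight.dFlagN_shift_lt`): every valid kangaroo flag `(true, g, h)` of the child, `ord h = n ≥ 2`, has
`d_𝓖 = dFlagN d! n (…) < d_𝓕`, so `F` dominates it STRICTLY in the first component.  `axisPackageKangaroo_holds` (the parent-side simultaneous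
cleaning, = stub-7's `AxisPackageN0` heart with the extra weight `(n, n+1)`) is the remaining input.
AI-written; gate-accepted means sorry-free with standard axioms, not refereed.
-/

set_option linter.dupNamespace false -- mandated namespace of this single-conjunct summit

noncomputable section

namespace Summit.ResolutionOfSingularities.ResolutionOfSingularities.Theorems

open Literature.AlgebraicGeometry.Resolution
open Literature.AlgebraicGeometry.Resolution.HauserPerlega2024 (Triple)

namespace WildMonic

open MvPowerSeries MonicDescent
open PurePowerFlag (swap swapE orient orientE IsN0 IsTangent succE)

variable {k : Type} [Field k] {d : ℕ}

/-- THE KANGAROO PACKAGE OF A CHARGED AXIS STEP (see the module docstring): for every tangency `n ≥ 2`, a valid non-terminal parent flag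
`(g₀, 0)` and a re-centring `ψ` of the swapped child making it `(1,n)`-clean, with Perlega's Prop. 6.2.4 inequality between them. -/
def AxisPackageKangaroo (d p : ℕ) (k : Type) [Field k] : Prop :=
  ∀ (A : Fin d → MvPowerSeries (Fin 2) k) (E : Finset (Fin 2)) (T : Fin d → MvPowerSeries (Fin 2) k) (φ' : MvPowerSeries (Fin 2) k),
    IsAxisStep d p A T φ' → ∀ n : ℕ, 2 ≤ n →
    ∃ (g₀ ψ : MvPowerSeries (Fin 2) k), constantCoeff g₀ = 0 ∧ constantCoeff ψ = 0 ∧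
      IsMMax d A E g₀ 0 ∧ 0 < dRes E (newtonSet (flagTuple d A g₀ 0)) ∧
      IsWClean p ![1, n] (flagTuple d (swapT (shift d T φ')) ψ 0) ∧
      wMin ![1, n] (flagTuple d (swapT (shift d T φ')) ψ 0) ≠ ⊤ ∧
      n * dInit ![1, n] (newtonSet (flagTuple d (swapT (shift d T φ')) ψ 0)) ≤ dRes E (newtonSet (flagTuple d A g₀ 0))

/-- A series of order `≥ 2` without constant term: its order as a natural number `n`, the vanishing below `n`, the non-zero coefficient at `n`. -/
theorem order_toNat_spec {h : PowerSeries k} (hh0 : h ≠ 0) (h2 : (2 : ℕ∞) ≤ h.order) :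
    2 ≤ h.order.toNat ∧ (∀ i, i < h.order.toNat → PowerSeries.coeff i h = 0) ∧ PowerSeries.coeff h.order.toNat h ≠ 0 := by
  have hfin : h.order ≠ ⊤ := by rwa [Ne, PowerSeries.order_eq_top]
  have hco : (h.order.toNat : ℕ∞) = h.order := ENat.coe_toNat hfin
  refine ⟨?_, fun i hi => PowerSeries.coeff_of_lt_order i ?_, PowerSeries.coeff_order hh0⟩
  · have : ((2 : ℕ) : ℕ∞) ≤ (h.order.toNat : ℕ∞) := by rw [hco]; exact_mod_cast h2
    exact_mod_cast this
  · rw [← hco]; exact_mod_cast hi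

/-- **Uk-ρD3: `DropAxisKangaroo` FROM THE KANGAROO PACKAGE** (Perlega Prop. 9.1.4 case (4) at `t = 0`). -/
theorem dropAxisKangaroo_of_package {p : ℕ} [Fact p.Prime] [CharP k p] (hpkg : AxisPackageKangaroo d p k) : DropAxisKangaroo d p k := by
  intro A E T φ' hstep g h hg hh htan h2 hmm
  classical
  -- the flag data
  have hh0 : h ≠ 0 := htan.2.1
  obtain ⟨hn2, hlow, hcn⟩ := order_toNat_spec hh0 h2
  set n := h.order.toNat with hn
  have htn : PurePowerFlag.tangency h = n := rfl
  have hnotN0 : ¬ IsN0 (swapE (succE (0 : k) E)) h := by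
    rintro (h1 | h0)
    · exact h1 htan.1
    · exact hh0 h0
  -- the package for this tangency
  obtain ⟨g₀, ψ, hg₀, hψ, hmax₀, hdpos, hclean, hfin, h624⟩ := hpkg A E T φ' hstep n hn2
  set C' := swapT (shift d T φ') with hC'
  set Astar := flagTuple d C' ψ 0 with hAstar
  set dF := dRes E (newtonSet (flagTuple d A g₀ 0)) with hdF
  -- the child flag tuple as a shift of the sheared clean tuple
  have hψσ : constantCoeff (subst (PurePowerFlag.shift h) ψ) = 0 := constantCoeff_subst_shear hh hψ
  have htuple : flagTuple d C' g h = shift d (fun j => subst (PurePowerFlag.shift h) (Astar j)) (g - subst (PurePowerFlag.shift h) ψ) := by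
    rw [hAstar, ← flagTuple_def, flagTuple_flagTuple C' ψ _ (map_zero _) hh, zero_add, add_sub_cancel]
  have htuple0 : flagTuple d C' (subst (PurePowerFlag.shift h) ψ) h = fun j => subst (PurePowerFlag.shift h) (Astar j) := by
    have h1 : flagTuple d C' (subst (PurePowerFlag.shift h) ψ) h = shift d (fun j => subst (PurePowerFlag.shift h) (Astar j)) 0 := by
      rw [hAstar, ← flagTuple_def, flagTuple_flagTuple C' ψ _ (map_zero _) hh, zero_add, add_zero]
    rw [h1, shift_zero]
  -- `wMin` of the clean tuple as a natural number
  obtain ⟨m, hm⟩ : ∃ m : ℕ, wMin ![1, n] Astar = m := ENat.ne_top_iff_exists.mp hfin |>.imp fun m hm => hm.symm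
  -- validity of `g` against `g' = subst (shift h) ψ`
  have hval : mFlagN d.factorial n (newtonSet (fun j => subst (PurePowerFlag.shift h) (Astar j))) ≤
      mFlagN d.factorial n (newtonSet (shift d (fun j => subst (PurePowerFlag.shift h) (Astar j)) (g - subst (PurePowerFlag.shift h) ψ))) := by
    have h1 := hmm _ hψσ
    rw [mOf_of_not_isN0 hnotN0, mOf_of_not_isN0 hnotN0, htn, htuple0, htuple] at h1
    exact h1
  -- the kangaroo bound
  have hdrop := dFlagN_shift_lt (w := ![1, n]) (by simp) (by simp) (by omega) hlow rfl hcn Astar p hn2 hclean hm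
    (g - subst (PurePowerFlag.shift h) ψ) hval hdpos h624
  rw [← htuple] at hdrop
  -- the dominating parent flag `(g₀, 0)`
  refine ⟨g₀, 0, hg₀, map_zero _, Or.inl (Or.inr rfl), hmax₀, ?_, Or.inl ?_⟩ <;>
    rw [flagTriple_of_not_isN0 hnotN0, flagTriple_of_isN0 (Or.inr rfl), htn]
  · exact le_of_lt (Prod.Lex.toLex_lt_toLex.mpr (Or.inl hdrop))
  · exact Prod.Lex.toLex_lt_toLex.mpr (Or.inl hdrop)

end WildMonic

end Summit.ResolutionOfSingularities.ResolutionOfSingularities.Theorems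

end
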